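import Literature.Geometry.Kaehler.ComplexTorusCyclotomicAutomorphismMumfordTateThreefolds
import Literature.NumberTheory.ComplexMultiplication.CMTorusInducedTypeProduct
import Literature.NumberTheory.ComplexMultiplication.CMTypeInducedFromPrimitive
import Literature.NumberTheory.ComplexMultiplication.CMTypeTorusAbelianVariety
import Literature.AlgebraicGeometry.ComplexMultiplication.PrimitiveCMTypeSimple
import Literature.AlgebraicGeometry.Motives.HodgeTensorFactsHolds
import HarnessLib

/-!
# `Hdg(Xᵏ) = Div(Xᵏ)` for every power of every model `ℂ^g/Φ(𝔞)` of a CM field of degree `≤ 6` — simple or not — and of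
# every complex torus with an endomorphism of characteristic polynomial `Φ_d`, `φ(d) ≤ 6` (orders `3, 4, 5, 7, 8, 9`; `P_u = Φ₁₀, Φ₁₂, Φ₁₄, Φ₁₈`)

Layer `Literature/Geometry/Kaehler`, namespace `Literature.Geometry.Kaehler.ComplexTorus`; sequel of this seat's
`ComplexTorusCyclotomicAutomorphismHodgeConjecturePowers` (generation 31 FILE 14: `divisorClasses_powPeriod_eq_hodgeClasses_of_iso_of_totient_le_six`
— WITH the hypothesis that the model `ℂ^g/Φ(𝔞)` be SIMPLE), `…MumfordTateThreefolds` ∕ `…OrderEightTwelve` ∕ `…OrderSixteen{,Hodge}` (the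
non-simple kinds level by level: `X ∼ E³`, `E²`, `B²`, `E⁴`), lane `lit-hodgefound` (Track 2 foundations library), prover seat
`lit-hodgefound-p10`, generation 33, row «A2-26(gs)» (self-proposed 2026-08-28).  THEOREMS ONLY (no definition, no named fact, no `sorry`).

THE ARGUMENT (uniform in the type).  Every CM type `Φ` of a CM field `K` is induced from a PRIMITIVE type `Φ₁` of a CM subfield `K₁`
(Streng Lemma I.3.5, tree `exists_primitive_inducedCMType_eq_of_isCMField`), and then `ℂ^g/Φ(𝔞) ∼ (ℂ^{g₁}/Φ₁(𝓞_{K₁}))^{[K:K₁]}` for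
every ideal `𝔞` (Shimura §6.2 THEOREM 3 at torus level, tree `isIsogenous_powPeriod_periodIso_of_basis`); `B = ℂ^{g₁}/Φ₁(𝓞_{K₁})` is a
SIMPLE abelian variety of CM type (`Φ₁` primitive) with an algebraic Mumford–Tate torus and `2 dim B = [K₁ : ℚ] ≤ [K : ℚ] ≤ 6`, so
«`Hdg = Div` on all powers of `B`» (Moonen–Zarhin: a simple abelian variety of CM type of dimension `≤ 3` is stably nondegenerate,
tree `IsAbelianVariety.divisorClasses_powPeriod_eq_hodgeClasses_of_isSimple_of_card_le_six_of_isTorusSubgroup_mumfordTateGroupC`), and this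
property passes along `X ∼ Bⁿ` (tree `forall_powPeriod_divisorClasses_eq_hodgeClasses_iff_of_isIsogenous_powPeriod`).

THE SOURCES.  B. J. J. Moonen, Yu. G. Zarhin, *Hodge classes on abelian varieties of low dimension*, Math. Ann. **315** (1999), Thm. 0.1
and (0.2)(4) (an abelian variety of CM type of dimension `≤ 3`: all Hodge classes on all powers are divisor classes unless …; the simple
CM case is stably nondegenerate), §1 (1.2); G. Shimura, *Abelian Varieties with Complex Multiplication and Modular Functions* (1998),
§6.1 Thm. 2, §6.2 Thm. 3 (pp. 42–44: the varieties of an induced type are isogenous to powers), §8.2 Prop. 26; M. Streng, *Complex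
multiplication of abelian surfaces*, thesis Leiden (2010), Ch. I Lemma 3.5; B. B. Gordon, *A survey of the Hodge conjecture for
abelian varieties* (1999), 7.6 and §9.3; Ch. Birkenhake, H. Lange, *Complex Abelian Varieties* (2004), §13.3.

## What is proved

* §1 (`K` a CM field, `[K : ℚ] ≤ 6`, ANY type `Φ`, ANY ideal `𝔞`): **`divisorClasses_powPeriod_periodIso_eq_hodgeClasses_of_finrank_le_six`**
  — `Hdg((ℂ^g/Φ(𝔞))ᵏ) = Div((ℂ^g/Φ(𝔞))ᵏ)` for all `k`; and the isotypic decomposition used: **`exists_isIsogenous_powPeriod_periodIso_simple`**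
  (any CM field: `ℂ^g/Φ(𝔞) ∼ Bⁿ` with `B = ℂ^{g₁}/Φ₁(𝓞_{K₁})` SIMPLE, an abelian variety, `n = [K : K₁] ≥ 1`, `2 dim B · n = [K : ℚ]`).
* §2 (complex tori `(X, u)` with `P_u = Φ_d`, `d > 2`, `φ(d) ≤ 6`): **`divisorClasses_powPeriod_eq_hodgeClasses_of_charpoly_eq_cyclotomic_of_totient_le_six`**
  (no simplicity hypothesis), the prime-power-order form **`divisorClasses_powPeriod_eq_hodgeClasses_of_orderOf_eq_of_totient_le_six`**
  (`u` of prime-power order `q`, `2 dim X = φ(q) ≤ 6`: orders `3, 4, 5, 7, 8, 9`), and the instances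
  `divisorClasses_powPeriod_eq_hodgeClasses_of_orderOf_eq_eight` (every `2`-torus with an automorphism of order `8`),
  `divisorClasses_powPeriod_eq_hodgeClasses_of_charpoly_eq_cyclotomic_twelve` (`P_u = Φ₁₂`).

NOT HERE: products of NON-isogenous CM factors (`E × E′`, `E × B`: not of the form `ℂ^g/Φ(𝔞)` for a field); `φ(d) ≥ 8` (the simple
ζ₁₆-fourfold is in `…OrderSixteenHodge`; `φ(d) = 8` in general contains Weil-type degenerate fourfolds for other fields).

## References

* [MoonenZarhin1999LowDim] B. Moonen, Yu. Zarhin, Math. Ann. 315 (1999), Thm. 0.1, (0.2)(4), §1 (1.2).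
* [Shimura1998] G. Shimura, *Abelian Varieties with Complex Multiplication and Modular Functions* (1998), §6.1 Thm. 2, §6.2 Thm. 3,
  §8.2 Prop. 26.
* [Streng2010] M. Streng, *Complex multiplication of abelian surfaces*, PhD thesis, Leiden (2010), Ch. I Lemma 3.5.
* [Gordon1999HodgeAVSurvey] B. B. Gordon (1999), 7.6, §9.3.
* [BirkenhakeLange2004] Ch. Birkenhake, H. Lange, *Complex Abelian Varieties*, 2nd ed. (2004), §13.3.
-/

noncomputable section

open scoped Classical nonZeroDivisors NumberField Manifold ContDiff MatrixGroups
open NumberField Module Polynomial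

namespace Literature.Geometry.Kaehler

namespace ComplexTorus

-- `open scoped`: the tree's action of `Aut(ℂ)` on `Hom(K, ℂ)` by composition (`ringEquivCompAction`) is a scoped instance
open scoped Literature.NumberTheory.ComplexMultiplication
open Literature.NumberTheory.Automorphic (IsTorusSubgroup)
open Literature.AlgebraicGeometry.Motives (CMType HodgeTensorFacts hodgeTensorFacts_holds)
open Literature.NumberTheory.ComplexMultiplication (IsPrimitive inducedCMType exists_primitive_inducedCMType_eq_of_isCMField)
open Literature.NumberTheory.ComplexMultiplication.CMTypeLattice (periodIso basisIndex card_basisIndex_eq_finrank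
  isSimple_periodIso_iff_isPrimitive isIsogenous_powPeriod_periodIso_of_basis isAbelianVariety_periodIso)
open Literature.AlgebraicGeometry.ComplexMultiplication (isPrimitive_ringEquiv_complex_iff)
open Literature.AlgebraicGeometry.Pohlmann1968.Cyclotomic (finrank_eq_totient)

/-! ### §1 The models `ℂ^g/Φ(𝔞)` of a CM field of degree `≤ 6` -/

section Models

variable {K : Type} [Field K] [NumberField K] [IsCMField K]

/-- **ISOTYPIC DECOMPOSITION OF `ℂ^g/Φ(𝔞)`** (any CM field `K`, any type, any ideal): there are a CM subfield `K₁ ⊆ K` and a PRIMITIVE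
type `Φ₁` of `K₁` inducing `Φ` such that `ℂ^g/Φ(𝔞) ∼ Bⁿ`, `B = ℂ^{g₁}/Φ₁(𝓞_{K₁})` a SIMPLE abelian variety, `n = [K : K₁] ≥ 1`,
`[K₁ : ℚ] · n = [K : ℚ]` (Streng's Lemma 3.5 with Shimura's THEOREM 3 at torus level). [cite: Shimura1998, §6.2 Thm. 3 (pp. 42–44), §8.2 Prop. 26]
[cite: Streng2010, Ch. I Lemma 3.5] -/
theorem exists_isIsogenous_powPeriod_periodIso_simple (Φ : CMType K) (I : (FractionalIdeal (𝓞 K)⁰ K)ˣ) :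
    ∃ (K₁ : IntermediateField ℚ K) (Φ₁ : CMType K₁), IsCMField K₁ ∧ inducedCMType (algebraMap K₁ K) Φ₁ = Φ ∧
      ComplexTorus.IsSimple (periodIso Φ₁ (1 : (FractionalIdeal (𝓞 K₁)⁰ K₁)ˣ)) ∧
      IsAbelianVariety (periodIso Φ₁ (1 : (FractionalIdeal (𝓞 K₁)⁰ K₁)ˣ)) ∧
      0 < finrank K₁ K ∧ finrank ℚ K₁ * finrank K₁ K = finrank ℚ K ∧
      IsIsogenous (periodIso Φ I) (powPeriod (periodIso Φ₁ (1 : (FractionalIdeal (𝓞 K₁)⁰ K₁)ˣ)) (finrank K₁ K)) := by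
  obtain ⟨K₁, Φ₁, hCM, h₁, hp₁, -⟩ := exists_primitive_inducedCMType_eq_of_isCMField Φ
  haveI := hCM
  obtain ⟨s₀⟩ : Nonempty (K₁ →+* ℂ) := inferInstance
  exact ⟨K₁, Φ₁, hCM, h₁,
    (isSimple_periodIso_iff_isPrimitive Φ₁ 1 s₀).2 ((isPrimitive_ringEquiv_complex_iff Φ₁ s₀).2 hp₁),
    isAbelianVariety_periodIso Φ₁ 1, Module.finrank_pos, Module.finrank_mul_finrank ℚ K₁ K,
    IsIsogenous.symm _ _ (isIsogenous_powPeriod_periodIso_of_basis h₁ (Module.finBasis K₁ K) I 1)⟩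

/-- **`Hdg((ℂ^g/Φ(𝔞))ᵏ) = Div((ℂ^g/Φ(𝔞))ᵏ)` FOR ALL `k`, FOR EVERY CM TYPE `Φ` OF A CM FIELD OF DEGREE `≤ 6` AND EVERY IDEAL `𝔞`** —
simple or not: `ℂ^g/Φ(𝔞) ∼ Bⁿ` with `B` a SIMPLE CM abelian variety of dimension `≤ 3` with algebraic Mumford–Tate torus (stably
nondegenerate, Moonen–Zarhin), and «`Hdg = Div` on all powers» passes along `X ∼ Bⁿ`. [cite: MoonenZarhin1999LowDim, Thm. 0.1, (0.2)(4) and §1 (1.2)]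
[cite: Shimura1998, §6.2 Thm. 3] [cite: Gordon1999HodgeAVSurvey, 7.6 and §9.3] -/
theorem divisorClasses_powPeriod_periodIso_eq_hodgeClasses_of_finrank_le_six (hK : finrank ℚ K ≤ 6) (Φ : CMType K)
    (I : (FractionalIdeal (𝓞 K)⁰ K)ˣ) (k p : ℕ) :
    divisorClasses (powPeriod (periodIso Φ I) k) p = hodgeClasses (powPeriod (periodIso Φ I) k) p := by
  haveI : HodgeTensorFacts.{0, 0} := hodgeTensorFacts_holds.{0, 0}
  obtain ⟨K₁, Φ₁, hCM, -, hS, hY, hn, hmul, hiso⟩ := exists_isIsogenous_powPeriod_periodIso_simple Φ I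
  haveI := hCM
  have hcard : Fintype.card (basisIndex (1 : (FractionalIdeal (𝓞 K₁)⁰ K₁)ˣ)) ≤ 6 := by
    rw [card_basisIndex_eq_finrank]
    nlinarith
  haveI : Nonempty (basisIndex (1 : (FractionalIdeal (𝓞 K₁)⁰ K₁)ˣ)) :=
    Fintype.card_pos_iff.1 (by rw [card_basisIndex_eq_finrank]; exact Module.finrank_pos)
  exact (forall_powPeriod_divisorClasses_eq_hodgeClasses_iff_of_isIsogenous_powPeriod hY hn hiso).2
    (fun k p ↦ hY.divisorClasses_powPeriod_eq_hodgeClasses_of_isSimple_of_card_le_six_of_isTorusSubgroup_mumfordTateGroupC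
      hS (isTorusSubgroup_mumfordTateGroupC_periodIso Φ₁ 1) hcard k p) k p

end Models

/-! ### §2 Complex tori with an endomorphism of characteristic polynomial `Φ_d`, `φ(d) ≤ 6` -/

section Tori

variable {ι : Type} [Fintype ι] [DecidableEq ι] {E : Type} [NormedAddCommGroup E] [NormedSpace ℂ E]
  {P : (ι → ℝ) ≃L[ℝ] E} {d : ℕ} [NeZero d]

set_option backward.isDefEq.respectTransparency false in -- Mathlib's instance
-- `IsCyclotomicExtension {d} ℚ (CyclotomicField d ℚ)` is keyed on `CyclotomicField.algebra`, the goal on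
-- `DivisionRing.toRatAlgebra` (same workaround as `ComplexTorusCyclotomicAutomorphismMumfordTateThreefolds`)
/-- **`Hdg(Xᵏ) = Div(Xᵏ)` FOR ALL `k`, FOR EVERY COMPLEX TORUS WITH AN ENDOMORPHISM OF CHARACTERISTIC POLYNOMIAL `Φ_d`, `d > 2`,
`φ(d) ≤ 6`** — SIMPLE OR NOT (`X ≅ ℂ^g/Φ(𝔞)` for a type of the CM field `ℚ(ζ_d)` of degree `φ(d) ≤ 6`, §1; generation 31 FILE 14 had
the simple case). [cite: MoonenZarhin1999LowDim, Thm. 0.1, (0.2)(4)] [cite: Shimura1998, §6.1 Thm. 2, §6.2 Thm. 3] [cite: BirkenhakeLange2004, §13.3] -/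
theorem divisorClasses_powPeriod_eq_hodgeClasses_of_charpoly_eq_cyclotomic_of_totient_le_six (hd : 2 < d) {A : Matrix ι ι ℤ}
    (hA : A ∈ endRingInt P) (hP : A.charpoly = cyclotomic d ℤ) (h6 : Nat.totient d ≤ 6) (k p : ℕ) :
    divisorClasses (powPeriod P k) p = hodgeClasses (powPeriod P k) p := by
  have hζ := IsCyclotomicExtension.zeta_spec d ℚ (CyclotomicField d ℚ)
  obtain ⟨Φ, I, e, he, he₂, -⟩ := exists_cmType_ideal_iso_of_charpoly_eq_cyclotomic hζ hA hP
  haveI : IsCMField (CyclotomicField d ℚ) :=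
    IsCyclotomicExtension.Rat.isCMField (CyclotomicField d ℚ) (S := ({d} : Set ℕ)) ⟨d, rfl, hd⟩
  have hK : finrank ℚ (CyclotomicField d ℚ) ≤ 6 := by rw [finrank_eq_totient d (CyclotomicField d ℚ)]; exact h6
  exact ((IsIsomorphic.isIsogenous ⟨e, he, he₂⟩).forall_powPeriod_divisorClasses_eq_hodgeClasses_iff.2
    (fun k p ↦ divisorClasses_powPeriod_periodIso_eq_hodgeClasses_of_finrank_le_six hK Φ I k p)) k p

omit [NeZero d] in
/-- **`Hdg(Xᵏ) = Div(Xᵏ)` for all `k`, for every complex torus of dimension `φ(q)/2 ≤ 3` with an endomorphism of PRIME-POWER order `q`**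
(`q ∈ {3, 4, 5, 7, 8, 9}`; then `P_u = Φ_q`). [cite: MoonenZarhin1999LowDim, Thm. 0.1, (0.2)(4)] [cite: BirkenhakeLange2004, §13.3] -/
theorem divisorClasses_powPeriod_eq_hodgeClasses_of_orderOf_eq_of_totient_le_six {q : ℕ} (hq : IsPrimePow q) {A : Matrix ι ι ℤ}
    (hA : A ∈ endRingInt P) (hord : orderOf A = q) (hdim : 2 * finrank ℂ E = Nat.totient q) (h6 : Nat.totient q ≤ 6) (k p : ℕ) :
    divisorClasses (powPeriod P k) p = hodgeClasses (powPeriod P k) p := by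
  haveI : NeZero q := ⟨hq.pos.ne'⟩
  have h2 : 2 < q := by
    rcases (hq.two_le).eq_or_lt with h | h
    · exfalso
      rw [← h, Nat.totient_two] at hdim
      omega
    · exact h
  exact divisorClasses_powPeriod_eq_hodgeClasses_of_charpoly_eq_cyclotomic_of_totient_le_six h2 hA
    (charpoly_eq_cyclotomic_of_orderOf_eq_of_finrank P hq hord hdim) h6 k p

/-- `8 = 2³` is a prime power. [folklore] -/
private theorem isPrimePow_eight₃₇ : IsPrimePow 8 :=
  (isPrimePow_nat_iff 8).2 ⟨2, 3, Nat.prime_two, by norm_num, by norm_num⟩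

omit [NeZero d] in
/-- **Every power of every `2`-torus with an automorphism of order `8` has `Hdg = Div`** (`X ∼ E × E`, `E` CM by `ℚ(i)` or `ℚ(√−2)`).
[cite: MoonenZarhin1999LowDim, Thm. 0.1, (0.2)(4)] [cite: BirkenhakeLange2004, §13.3] -/
theorem divisorClasses_powPeriod_eq_hodgeClasses_of_orderOf_eq_eight {A : Matrix ι ι ℤ} (hA : A ∈ endRingInt P)
    (hord : orderOf A = 8) (hdim : finrank ℂ E = 2) (k p : ℕ) :
    divisorClasses (powPeriod P k) p = hodgeClasses (powPeriod P k) p :=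
  divisorClasses_powPeriod_eq_hodgeClasses_of_orderOf_eq_of_totient_le_six isPrimePow_eight₃₇ hA hord
    (by rw [hdim]; decide) (by decide) k p

omit [NeZero d] in
/-- **Every power of every complex torus with an endomorphism of characteristic polynomial `Φ₁₂` has `Hdg = Div`** (`X ∼ E × E`, `E` CM by
`ℚ(i)` or `ℚ(√−3)`). [cite: MoonenZarhin1999LowDim, Thm. 0.1, (0.2)(4)] [cite: BirkenhakeLange2004, §13.3] -/
theorem divisorClasses_powPeriod_eq_hodgeClasses_of_charpoly_eq_cyclotomic_twelve {A : Matrix ι ι ℤ} (hA : A ∈ endRingInt P)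
    (hP : A.charpoly = cyclotomic 12 ℤ) (k p : ℕ) : divisorClasses (powPeriod P k) p = hodgeClasses (powPeriod P k) p :=
  divisorClasses_powPeriod_eq_hodgeClasses_of_charpoly_eq_cyclotomic_of_totient_le_six (d := 12) (by norm_num) hA hP (by decide) k p

end Tori

end ComplexTorus

end Literature.Geometry.Kaehler

end
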